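import Summits.ResolutionOfSingularities.ResolutionOfSingularities.Theses.EquisingularLift
import Literature.AlgebraicGeometry.HodgeTheory.BlochSemiregularityMapReal
import Literature.AlgebraicGeometry.Morphisms.CechModule
import HarnessLib

/-!
# Route `EquisingularLift`, crux EL♮ (stmt-ResolutionOfSingularities-20038) / EL♮(3) (stmt-…-20148) — named DOWNSTAIRS predicates
# of the lead's skeleton, rung v8 (DIR₀ «direction sections of the exceptional ruled surface over a rational carrier curve»)

res-L1-w45b-lead-2 g1 (lead) with res-type-027 (the `DirStep*` clauses, fragment `L/res-type-027/DIRSTEP.lean` 2c225bf73b11508a,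
delivered on the lead's text deal 2026-08-27T11:08:34Z). OURS; planning vocabulary of the crux chain, not a statement of any manuscript;
AI-written, weaker than expert review. Every predicate below is DOWNSTAIRS-ONLY (objects on the `k`-side stages of an embedded resolution
datum; no `O`-data), so that a registered rung stub «downstairs closure ⇒ horizontal EL♮» stays checkable on specimens.

* `redSub G Z hZ` / `redSubι` — the reduced closed subscheme `V(Z)_red = (vanishingIdeal ⟨Z,hZ⟩).subscheme` and its immersion (the chain's spelling).
* `DirStepSec` — «the curve `Γ ⊆ G` is a SECTION of the running exceptional ruled surface over the carrier curve `Z₉ ⊆ F₉`»: the reduced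
  `Γ̃` maps ISOMORPHICALLY onto `Z̃₉` under `G → F₁₀ → F₉` (bijectivity would be too weak in characteristic `p`).
* `DirStepUnobs` — «embedded deformations of `Γ` in the surface `E` are unobstructed»: `H¹(Γ̃, 𝒩_{Γ̃/Ẽ}) = 0` in the tree's Čech vocabulary
  (`Morphisms.CechMH1` of `HodgeTheory.normalSheaf` on a two-chart affine cover; cover-independent by `subsingleton_cechMH1_iff_of_isAffineOpen`).
  For a section of a `ℙ¹`-bundle over `ℙ¹` this is `Γ·Γ ≥ −1`.
* `DirStep F₉ F₁₀ υ' Z₉ hZ₉ R₁` — closure of a stage predicate `R₁ G γ T E` (over `F₁₀`) under ONE DIRECTION STEP: blow up such a `Γ ⊆ E ∩ T`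
  (ambient and `Ẽ` regular along `Γ`), continue with `T ↦ closure υ₂⁻¹(T ∖ Γ)` and `E ↦ υ₂⁻¹ Γ` or `E ↦ closure υ₂⁻¹(E ∖ Γ)`.
* `ReachDirZero F₁ F₂ υ x T₂ F' β T'` — the ADMISSIBLE SUB-CHAIN PREDICATE of rung v8 in the currency of res-D-pv-029's engine K5′
  (`target_elnat_of_subchainResolution'`, p523491; slot `Reach`): after the point step `υ` at `x` with running strict transform `T₂`,
  (TC⁺-part, = the clauses of the registered rung-v7 stub `stub_elnat_tcPlusPointResolution` / TC⁺-INST p524774) a locally principal `W ∋ x`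
  with `¬ υ⁻¹{x} ⊆ St W`, the in-carrier point closure from `(F₂, 𝟙, T₂, υ⁻¹{x} ∩ St W, false)` reaching `(F₉, β₉, T₉, Z₉, b₉)`, the blow-up
  `υ' : F₁₀ → F₉` of the carrier curve `Z₉` (`Z₉ ⊆ T₉`, `T₉ ⊄ Z₉`, finitely many singular points); then (DIR-part) the `DirStep`-closure from the
  seed `(F₁₀, 𝟙, closure υ'⁻¹(T₉ ∖ Z₉), υ'⁻¹ Z₉)` reaches `(F', γ', T', E')`, and `β = (γ' ≫ υ') ≫ β₉`. The empty DIR-part gives back ReachTC⁺.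

The registered v8 stub is then K5′'s downstairs hypothesis at `Reach := ReachDirZero` ⇒ horizontal EL♮, its conditional instance is ONE application
of K5′, and the upstairs debt is `HSUB′(ReachDirZero)` (supplier census in `L/res-type-027/DIRSTEP.lean`: chartwise `E_C ≅ ℙ(𝒞)`, the relative
Euler sequence on a section, `Pic ℙ¹ = ℤ`, T-P1VB `P1VB.exists_nowhereVanishing_lift`, the chartwise `O`-flat centre — all M-sized, none a named fact).
-/

set_option linter.dupNamespace false

noncomputable section

open CategoryTheory AlgebraicGeometry TopologicalSpace
open Literature.AlgebraicGeometry.Morphisms (CechMH1)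
open Literature.AlgebraicGeometry.HodgeTheory (normalSheaf)
open Literature.AlgebraicGeometry.Resolution (IsBlowup)

namespace Summit.ResolutionOfSingularities.ResolutionOfSingularities.Cruxes.EquisingularLiftNat.Sections

/-- The reduced closed subscheme on a closed subset (the chain's spelling `(vanishingIdeal ⟨Z, hZ⟩).subscheme`). -/
abbrev redSub (G : Scheme.{0}) (Z : Set G) (hZ : IsClosed Z) : Scheme.{0} :=
  (Scheme.IdealSheafData.vanishingIdeal (⟨Z, hZ⟩ : Closeds G)).subscheme

/-- Its closed immersion into `G`. -/
abbrev redSubι (G : Scheme.{0}) (Z : Set G) (hZ : IsClosed Z) : redSub G Z hZ ⟶ G :=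
  (Scheme.IdealSheafData.vanishingIdeal (⟨Z, hZ⟩ : Closeds G)).subschemeι

/-- **DIRSTEP / (sec)** «`Γ` is a SECTION of the ruled surface over the carrier curve»: the reduced curve `Γ̃ ⊆ G` maps ISOMORPHICALLY onto the
reduced carrier curve `Z̃₉ ⊆ F₉` under `G → F₁₀ → F₉` (some = the unique factorisation through `Z̃₉ ↪ F₉` is an isomorphism). Downstairs only. -/
def DirStepSec (F₉ F₁₀ : Scheme.{0}) (υ' : F₁₀ ⟶ F₉) (Z₉ : Set F₉) (hZ₉ : IsClosed Z₉)
    (G : Scheme.{0}) (γ : G ⟶ F₁₀) (Γ : Set G) (hΓ : IsClosed Γ) : Prop :=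
  ∃ δ : redSub G Γ hΓ ⟶ redSub F₉ Z₉ hZ₉, δ ≫ redSubι F₉ Z₉ hZ₉ = redSubι G Γ hΓ ≫ γ ≫ υ' ∧ IsIso δ

/-- **DIRSTEP / (unobs)** «the embedded deformations of `Γ` in the surface `E` are UNOBSTRUCTED»: for the (unique) closed immersion `i : Γ̃ ⟶ Ẽ` of
reduced structures over `G`, the first Čech cohomology of the normal sheaf `𝒩_{Γ̃/Ẽ}` (tree `HodgeTheory.normalSheaf i`) VANISHES on some cover of
`Γ̃` by two affine opens with affine intersection: `Subsingleton (CechMH1 Γ̃.toSpecΓ (normalSheaf i) V)` (tree `Morphisms/CechModule`; the structure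
map only fixes the scalar action, irrelevant for vanishing). For a section of a `ℙ¹`-bundle over `ℙ¹`: `⟺ deg 𝒩_{Γ/E} = Γ·Γ ≥ −1`. Downstairs only. -/
def DirStepUnobs (G : Scheme.{0}) (E : Set G) (hE : IsClosed E) (Γ : Set G) (hΓ : IsClosed Γ) : Prop :=
  ∀ i : redSub G Γ hΓ ⟶ redSub G E hE, i ≫ redSubι G E hE = redSubι G Γ hΓ →
    ∃ V : Fin 2 → (redSub G Γ hΓ).Opens, (∀ j, IsAffineOpen (V j)) ∧ IsAffineOpen (V 0 ⊓ V 1) ∧ ⨆ j, V j = ⊤ ∧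
      Subsingleton (CechMH1 (redSub G Γ hΓ).toSpecΓ (normalSheaf i) V)

/-- **DIRSTEP** — the closure constructor of ONE DIRECTION STEP for a stage predicate `R₁ G γ T E` over `F₁₀` (stage = ambient `G` with its map
`γ : G ⟶ F₁₀`, running strict transform `T`, running exceptional ruled surface `E`): if `Γ ⊆ E ∩ T` is an irreducible closed curve which is a SECTION of
`E` over the carrier (`DirStepSec`), along which the ambient and the reduced surface `Ẽ` are regular, with UNOBSTRUCTED embedded deformations in `E`
(`DirStepUnobs`), and `υ₂ : G' ⟶ G` is the blow-up of the reduced `Γ`, then the new stage `(G', υ₂ ≫ γ, closure υ₂⁻¹(T ∖ Γ), E')` is in `R₁`, for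
`E' = υ₂⁻¹ Γ` (the new ruled surface over the rational `Γ`) AND for `E' = closure υ₂⁻¹(E ∖ Γ)` (`St E ≅ E`). The seed `R₁ F₁₀ (𝟙 _) T₁₀ (υ'⁻¹ Z₉)` and
the quantification over `R₁` belong to lead-2's K5′ INST text. -/
def DirStep (F₉ F₁₀ : Scheme.{0}) (υ' : F₁₀ ⟶ F₉) (Z₉ : Set F₉) (hZ₉ : IsClosed Z₉)
    (R₁ : ∀ G : Scheme.{0}, (G ⟶ F₁₀) → Set G → Set G → Prop) : Prop :=
  ∀ (G G' : Scheme.{0}) (γ : G ⟶ F₁₀) (T E : Set G) (hE : IsClosed E) (Γ : Set G) (hΓ : IsClosed Γ) (υ₂ : G' ⟶ G),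
    R₁ G γ T E →
    Γ ⊆ E ∩ T →
    IsIrreducible Γ →
    DirStepSec F₉ F₁₀ υ' Z₉ hZ₉ G γ Γ hΓ →
    (∀ x : redSub G Γ hΓ, IsRegularLocalRing (G.presheaf.stalk (redSubι G Γ hΓ x))) →
    (∀ (i : redSub G Γ hΓ ⟶ redSub G E hE), i ≫ redSubι G E hE = redSubι G Γ hΓ →
      ∀ x : redSub G Γ hΓ, IsRegularLocalRing ((redSub G E hE).presheaf.stalk (i x))) →
    DirStepUnobs G E hE Γ hΓ →
    IsBlowup υ₂ (Scheme.IdealSheafData.vanishingIdeal (⟨Γ, hΓ⟩ : Closeds G)) →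
    R₁ G' (υ₂ ≫ γ) (closure (υ₂ ⁻¹' (T \ Γ))) (υ₂ ⁻¹' Γ) ∧
      R₁ G' (υ₂ ≫ γ) (closure (υ₂ ⁻¹' (T \ Γ))) (closure (υ₂ ⁻¹' (E \ Γ)))

/-- **ReachDirZero** — the admissible downstairs sub-chain predicate of rung v8 (DIR₀) for K5′'s slot `Reach` (see the module docstring):
TC⁺-part (locally principal `W ∋ x` not containing the exceptional divisor after strict transform, in-carrier point closure with the
≤-one-singular-point flag, blow-up of the carrier curve `Z₉`) followed by the `DirStep`-closure (direction sections of the running exceptional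
ruled surface), ending at `(F', β = (γ' ≫ υ') ≫ β₉, T')`. Downstairs only. -/
def ReachDirZero (F₁ F₂ : AlgebraicGeometry.Scheme.{0}) (υ : F₂ ⟶ F₁) (x : F₁) (T₂ : Set F₂)
    (F' : AlgebraicGeometry.Scheme.{0}) (β : F' ⟶ F₂) (T' : Set F') : Prop :=
  ∃ (W : Set F₁) (F₉ : AlgebraicGeometry.Scheme.{0}) (β₉ : F₉ ⟶ F₂) (T₉ Z₉ : Set F₉) (b₉ : Bool) (hZ₉ : IsClosed Z₉)
    (F₁₀ : AlgebraicGeometry.Scheme.{0}) (υ' : F₁₀ ⟶ F₉) (γ' : F' ⟶ F₁₀) (E' : Set F'),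
    ((x ∈ W) ∧ (¬ (υ ⁻¹' {x} ⊆ closure (υ ⁻¹' (W \ {x})))) ∧ ((∃ U : F₁.affineOpens, x ∈ (U : F₁.Opens) ∧ ((AlgebraicGeometry.Scheme.IdealSheafData.vanishingIdeal (⟨closure W, isClosed_closure⟩ : TopologicalSpace.Closeds F₁)).ideal U).IsPrincipal)) ∧ ((υ ⁻¹' {x} ∩ closure (υ ⁻¹' (W \ {x}))) ⊆ T₂) ∧ ((∀ R : (∀ G : AlgebraicGeometry.Scheme.{0}, (G ⟶ F₂) → Set G → Set G → Bool → Prop), R F₂ (CategoryTheory.CategoryStruct.id F₂) (T₂) (υ ⁻¹' {x} ∩ closure (υ ⁻¹' (W \ {x}))) false → (∀ (G₁ G₂ : AlgebraicGeometry.Scheme.{0}) (β : G₁ ⟶ F₂) (T Z : Set G₁) (b : Bool) (y : ↥((AlgebraicGeometry.Scheme.IdealSheafData.vanishingIdeal (⟨closure Z, isClosed_closure⟩ : TopologicalSpace.Closeds G₁))).subscheme) (υ₁ : G₂ ⟶ G₁) (hy : IsClosed ({(((AlgebraicGeometry.Scheme.IdealSheafData.vanishingIdeal (⟨closure Z, isClosed_closure⟩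 : TopologicalSpace.Closeds G₁))).subschemeι y : G₁)} : Set G₁)), R G₁ β T Z b → (((AlgebraicGeometry.Scheme.IdealSheafData.vanishingIdeal (⟨closure Z, isClosed_closure⟩ : TopologicalSpace.Closeds G₁))).subschemeι y : G₁) ∈ T → IsRegularLocalRing (((AlgebraicGeometry.Scheme.IdealSheafData.vanishingIdeal (⟨closure Z, isClosed_closure⟩ : TopologicalSpace.Closeds G₁))).subscheme.presheaf.stalk y) → IsRegularLocalRing (G₁.presheaf.stalk (((AlgebraicGeometry.Scheme.IdealSheafData.vanishingIdeal (⟨closure Z, isClosed_closure⟩ : TopologicalSpace.Closeds G₁))).subschemeι y : G₁)) → Literature.AlgebraicGeometry.Resolution.IsBlowup υ₁ (AlgebraicGeometry.Scheme.IdealSheafData.vanishingIdeal (⟨{(((AlgebraicGeometry.Scheme.IdealSheafData.vanishingIdeal (⟨closure Z, isClosed_closure⟩ : TopologicalSpace.Closeds G₁))).subschemeι y : G₁)}, hy⟩ : TopologicalSpace.Closeds G₁)) → R G₂ (CategoryTheory.CategoryStruct.comp υ₁ β) (closure (υ₁ ⁻¹' (T \ {(((AlgebraicGeometry.Scheme.IdealSheafData.vanishingIdeal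 (⟨closure Z, isClosed_closure⟩ : TopologicalSpace.Closeds G₁))).subschemeι y : G₁)}))) (closure (υ₁ ⁻¹' (Z \ {(((AlgebraicGeometry.Scheme.IdealSheafData.vanishingIdeal (⟨closure Z, isClosed_closure⟩ : TopologicalSpace.Closeds G₁))).subschemeι y : G₁)}))) b) → (∀ (G₁ G₂ : AlgebraicGeometry.Scheme.{0}) (β : G₁ ⟶ F₂) (T Z : Set G₁) (y : ↥((AlgebraicGeometry.Scheme.IdealSheafData.vanishingIdeal (⟨closure Z, isClosed_closure⟩ : TopologicalSpace.Closeds G₁))).subscheme) (υ₁ : G₂ ⟶ G₁) (hy : IsClosed ({(((AlgebraicGeometry.Scheme.IdealSheafData.vanishingIdeal (⟨closure Z, isClosed_closure⟩ : TopologicalSpace.Closeds G₁))).subschemeι y : G₁)} : Set G₁)), R G₁ β T Z false → (((AlgebraicGeometry.Scheme.IdealSheafData.vanishingIdeal (⟨closure Z, isClosed_closure⟩ : TopologicalSpace.Closeds G₁))).subschemeι y : G₁) ∈ T → ¬ IsRegularLocalRing (((AlgebraicGeometry.Scheme.IdealSheafData.vanishingIdeal (⟨closure Z, isClosed_closure⟩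 : TopologicalSpace.Closeds G₁))).subscheme.presheaf.stalk y) → IsRegularLocalRing (G₁.presheaf.stalk (((AlgebraicGeometry.Scheme.IdealSheafData.vanishingIdeal (⟨closure Z, isClosed_closure⟩ : TopologicalSpace.Closeds G₁))).subschemeι y : G₁)) → Literature.AlgebraicGeometry.Resolution.IsBlowup υ₁ (AlgebraicGeometry.Scheme.IdealSheafData.vanishingIdeal (⟨{(((AlgebraicGeometry.Scheme.IdealSheafData.vanishingIdeal (⟨closure Z, isClosed_closure⟩ : TopologicalSpace.Closeds G₁))).subschemeι y : G₁)}, hy⟩ : TopologicalSpace.Closeds G₁)) → R G₂ (CategoryTheory.CategoryStruct.comp υ₁ β) (closure (υ₁ ⁻¹' (T \ {(((AlgebraicGeometry.Scheme.IdealSheafData.vanishingIdeal (⟨closure Z, isClosed_closure⟩ : TopologicalSpace.Closeds G₁))).subschemeι y : G₁)}))) (closure (υ₁ ⁻¹' (Z \ {(((AlgebraicGeometry.Scheme.IdealSheafData.vanishingIdeal (⟨closure Z, isClosed_closure⟩ : TopologicalSpace.Closeds G₁))).subschemeι y : G₁)}))) true) → R F₉ β₉ T₉ Z₉ b₉)) ∧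 (Z₉ ⊆ T₉) ∧ (¬ (T₉ ⊆ Z₉)) ∧ (Set.Finite {z : ↥((AlgebraicGeometry.Scheme.IdealSheafData.vanishingIdeal (⟨Z₉, hZ₉⟩ : TopologicalSpace.Closeds F₉))).subscheme | ¬ IsRegularLocalRing (((AlgebraicGeometry.Scheme.IdealSheafData.vanishingIdeal (⟨Z₉, hZ₉⟩ : TopologicalSpace.Closeds F₉))).subscheme.presheaf.stalk z)}) ∧ (Literature.AlgebraicGeometry.Resolution.IsBlowup υ' (AlgebraicGeometry.Scheme.IdealSheafData.vanishingIdeal (⟨Z₉, hZ₉⟩ : TopologicalSpace.Closeds F₉)))) ∧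
    (∀ R₁ : (∀ G : AlgebraicGeometry.Scheme.{0}, (G ⟶ F₁₀) → Set G → Set G → Prop),
      R₁ F₁₀ (𝟙 F₁₀) (closure (υ' ⁻¹' (T₉ \ Z₉))) (υ' ⁻¹' Z₉) → DirStep F₉ F₁₀ υ' Z₉ hZ₉ R₁ → R₁ F' γ' T' E') ∧
    β = (γ' ≫ υ') ≫ β₉

end Summit.ResolutionOfSingularities.ResolutionOfSingularities.Cruxes.EquisingularLiftNat.Sections

end
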